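import Summits.NavierStokesRegularity.OSWSelfSimilar.MoebiusAdaptedCircleMap
import Literature.Analysis.Fourier.HilbertTransformCircleMoebiusConstant
import HarnessLib

/-!
# The Hilbert-transform identity of the Z3-U twin engine «u5t» is exact: `(H_x ω)∘X = H_θ(ω∘X) − ((s²−1)/2π) ∫ (ω∘X) sin θ/D dθ`

MODEL-side kernel companion of the ns-blowup profile programme (zone Z3, case Z3-U TWIN, engine «u5t» = co-moving conformally adapted
Fourier collocation for the 1-D gCLM model on `𝕋`, seat ns-blowup-profile-eng-5; HOME/profile/z3twin/ENGINE-E5.md §11, PREREG-U-TWIN §1).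
The engine represents the vorticity through `g = ω ∘ X`, `x = X(θ) = x_c + Θ_s⁻¹(θ)` with `Θ_s(y) = 2 arctan(s tan(y/2))`
(`MoebiusAdaptedCircleMap.moebiusAngle`, p492477: `Θ_s′ = P_ρ`, `ρ = (s−1)/(s+1)`), evaluates the Hilbert transform of the band-limited
`g` in `θ` by the Fourier multiplier, and uses the identity

  `(H_x ω)(X(θ)) = (H_θ g)(θ) − ((s² − 1)/2π) ∫₀^{2π} g(θ′) sin θ′/((s² + 1) + (s² − 1) cos θ′) dθ′`,

so far «engine-checked to 1e-16» (ENGINE-E5 §11 T1, kit j264988) and expressly NOT claimed in the kernel (STATUS l.7540). This file makes it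
a theorem for every band-limited `g` (real trigonometric polynomial in `θ`), every `s > 0`, every centre `x_c` and every evaluation point
off the single pole line `x ≡ x_c + π (mod 2π)` (where `tan` is undefined and Lean's `moebiusAngle` takes a junk value):

* `cexp_moebiusAngle_mul_I` — `e^{iΘ_s(y)} = (e^{iy} − ρ)/(1 − ρe^{iy})` whenever `cos(y/2) ≠ 0`: `Θ_s` IS the boundary map of the disc
  automorphism `Φ_ρ(w) = (w − ρ)/(1 − ρw)` (off the null set `π + 2πℤ`), hence an admissible lift for the Literature covariance theorem
  `Literature.Analysis.Fourier.hilbertTransformCircle_trigPoly_moebius_integral` (p496582/p497073 + the conjugate-Poisson constant);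
* `conjPoisson_kernel_eq_engine_kernel` — `2ρ sin θ/(1 + 2ρ cos θ + ρ²) = (s² − 1) sin θ/((s² + 1) + (s² − 1) cos θ)`;
* **`u5t_hilbertTransform_identity`** — the displayed identity, with `H = Literature.Analysis.Fourier.hilbertTransformCircle` on both sides
  (p.v. `cot` kernel, `H cos = sin` — the model's convention `u_x = Hω`) and the translation `x_c` included.

WHAT THIS IS NOT: not NS, not a statement about the gCLM dynamics — an exact identity of classical harmonic analysis (conformal
covariance of the conjugate function) specialised to the engine's change of variables; it certifies the engine's FORMULA, not its
floating-point evaluation. No definitions, no named facts.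
-/

noncomputable section

namespace Summit.NavierStokesRegularity.OSWSelfSimilar.MoebiusAngleHilbertCovariance

open Literature.Analysis.Fourier Summit.NavierStokesRegularity.OSWSelfSimilar.MoebiusAdaptedCircleMap
open Complex Set MeasureTheory
open scoped Real

/-! ### `Θ_s` is the boundary map of `Φ_ρ`, `ρ = (s − 1)/(s + 1)` -/

/-- `e^{2i arctan q} = (1 + iq)/(1 − iq)` (helper). [folklore] -/
private theorem cexp_two_arctan_mul_I (q : ℝ) :
    Complex.exp (((2 * Real.arctan q : ℝ) : ℂ) * I) = (1 + q * I) / (1 - q * I) := by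
  have hne : (1 : ℂ) - q * I ≠ 0 := by
    intro h
    have := congrArg Complex.re h
    simp at this
  have hq2 : (0 : ℝ) < 1 + q ^ 2 := by positivity
  have hsq : Real.sqrt (1 + q ^ 2) ^ 2 = 1 + q ^ 2 := Real.sq_sqrt hq2.le
  have hcos : Real.cos (2 * Real.arctan q) = (1 - q ^ 2) / (1 + q ^ 2) := by
    rw [Real.cos_two_mul, Real.cos_sq_arctan]
    field_simp
    ring
  have hsc : Real.sin (Real.arctan q) * Real.cos (Real.arctan q) = q / (1 + q ^ 2) := by
    rw [Real.sin_arctan, Real.cos_arctan, div_mul_div_comm, mul_one, ← pow_two, hsq]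
  have hsin : Real.sin (2 * Real.arctan q) = 2 * q / (1 + q ^ 2) := by
    rw [Real.sin_two_mul, mul_assoc, hsc]
    ring
  rw [Complex.exp_mul_I, ← Complex.ofReal_cos, ← Complex.ofReal_sin, hcos, hsin, eq_div_iff hne]
  have hD : (1 : ℝ) + q ^ 2 ≠ 0 := hq2.ne'
  apply Complex.ext
  · simp only [Complex.mul_re, Complex.add_re, Complex.add_im, Complex.mul_im, Complex.ofReal_re, Complex.ofReal_im,
      Complex.I_re, Complex.I_im, Complex.one_re, Complex.one_im, Complex.sub_re, Complex.sub_im]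
    field_simp
    ring
  · simp only [Complex.mul_re, Complex.add_re, Complex.add_im, Complex.mul_im, Complex.ofReal_re, Complex.ofReal_im,
      Complex.I_re, Complex.I_im, Complex.one_re, Complex.one_im, Complex.sub_re, Complex.sub_im]
    field_simp
    ring

/-- Half-angle form of a point of the unit circle: `e^{iy} (1 − i tan(y/2)) = 1 + i tan(y/2)` whenever `cos(y/2) ≠ 0` (helper).
[folklore] -/
private theorem cexp_mul_one_sub_tan_half {y : ℝ} (hy : Real.cos (y / 2) ≠ 0) :
    Complex.exp (y * I) * (1 - Real.tan (y / 2) * I) = 1 + Real.tan (y / 2) * I := by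
  set C : ℝ := Real.cos (y / 2) with hC
  set S : ℝ := Real.sin (y / 2) with hS
  have hCS : S ^ 2 + C ^ 2 = 1 := Real.sin_sq_add_cos_sq (y / 2)
  have hcos : Real.cos y = C ^ 2 - S ^ 2 := by
    have h := Real.cos_two_mul (y / 2)
    rw [show 2 * (y / 2) = y by ring] at h
    rw [h, hC]
    nlinarith [hCS]
  have hsin : Real.sin y = 2 * S * C := by
    have h := Real.sin_two_mul (y / 2)
    rwa [show 2 * (y / 2) = y by ring] at h
  have htan : Real.tan (y / 2) = S / C := Real.tan_eq_sin_div_cos _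
  rw [Complex.exp_mul_I, ← Complex.ofReal_cos, ← Complex.ofReal_sin, htan, hcos, hsin]
  have hc : (C : ℂ) ≠ 0 := by exact_mod_cast hy
  apply Complex.ext
  · simp only [Complex.mul_re, Complex.add_re, Complex.add_im, Complex.mul_im, Complex.ofReal_re, Complex.ofReal_im,
      Complex.I_re, Complex.I_im, Complex.one_re, Complex.one_im, Complex.sub_re, Complex.sub_im]
    field_simp
    linear_combination C * hCS
  · simp only [Complex.mul_re, Complex.add_re, Complex.add_im, Complex.mul_im, Complex.ofReal_re, Complex.ofReal_im,
      Complex.I_re, Complex.I_im, Complex.one_re, Complex.one_im, Complex.sub_re, Complex.sub_im]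
    field_simp
    linear_combination S * hCS

/-- **`Θ_s` is the boundary map of `Φ_ρ`.** For `s > 0`, `ρ = (s − 1)/(s + 1)` and every `y` with `cos(y/2) ≠ 0`:
`e^{iΘ_s(y)} = (e^{iy} − ρ)/(1 − ρe^{iy})`, `Θ_s(y) = moebiusAngle s y = 2 arctan(s tan(y/2))` — the engine's change of variables is the
boundary correspondence of the disc automorphism fixing `±1` (off the pole line `y ∈ π + 2πℤ`, where `tan(y/2)` is undefined).
[folklore] -/
theorem cexp_moebiusAngle_mul_I {s : ℝ} (hs : 0 < s) {y : ℝ} (hy : Real.cos (y / 2) ≠ 0) :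
    Complex.exp (moebiusAngle s y * I)
      = (Complex.exp (y * I) - (((s - 1) / (s + 1) : ℝ) : ℂ)) / (1 - (((s - 1) / (s + 1) : ℝ) : ℂ) * Complex.exp (y * I)) := by
  set ρ : ℝ := (s - 1) / (s + 1) with hρdef
  set t : ℝ := Real.tan (y / 2) with ht
  set e : ℂ := Complex.exp (y * I) with he
  have hs1 : s + 1 ≠ 0 := by positivity
  have hρs : s * (1 - ρ) = 1 + ρ := by
    rw [hρdef]
    field_simp
    ring
  have hρ : |ρ| < 1 := abs_moebius_rho_lt_one hs
  -- the two denominators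
  have hden1 : (1 : ℂ) - (s * t : ℝ) * I ≠ 0 := by
    intro h
    have := congrArg Complex.re h
    simp at this
  have hden2 : (1 : ℂ) - (ρ : ℂ) * e ≠ 0 := by
    intro h
    have h1 : (ρ : ℂ) * e = 1 := (sub_eq_zero.mp h).symm
    have h2 : ‖(ρ : ℂ) * e‖ = 1 := by rw [h1, norm_one]
    rw [norm_mul, Complex.norm_real, Real.norm_eq_abs, he, Complex.norm_exp_ofReal_mul_I, mul_one] at h2
    linarith
  -- `e^{iΘ} = (1 + istI)/(1 − istI)`
  have h1 : Complex.exp (moebiusAngle s y * I) = (1 + (s * t : ℝ) * I) / (1 - (s * t : ℝ) * I) := by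
    have : moebiusAngle s y = 2 * Real.arctan (s * t) := by simp [moebiusAngle, ht]
    rw [this]
    exact_mod_cast cexp_two_arctan_mul_I (s * t)
  rw [h1, div_eq_div_iff hden1 hden2]
  have he' : e * (1 - (t : ℂ) * I) = 1 + (t : ℂ) * I := cexp_mul_one_sub_tan_half hy
  have hρs' : (s : ℂ) * (1 - ρ) = 1 + ρ := by exact_mod_cast hρs
  push_cast
  linear_combination (-(1 + (ρ : ℂ))) * he' + ((t : ℂ) * I * (1 + e)) * hρs'

/-- The pole line is a null set: `cos((y − x_c)/2) ≠ 0` for almost every `y` (the exceptional set is `x_c + π + 2πℤ`). [folklore] -/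
theorem ae_cos_half_sub_ne_zero (x_c : ℝ) : ∀ᵐ y : ℝ, Real.cos ((y - x_c) / 2) ≠ 0 := by
  have hsub : {y : ℝ | Real.cos ((y - x_c) / 2) = 0} ⊆ Set.range fun k : ℤ => x_c + (2 * (k : ℝ) + 1) * π := by
    intro y hy
    obtain ⟨k, hk⟩ := Real.cos_eq_zero_iff.mp hy
    exact ⟨k, by linarith [hk]⟩
  have hnull : volume {y : ℝ | Real.cos ((y - x_c) / 2) = 0} = 0 :=
    measure_mono_null hsub ((Set.countable_range _).measure_zero volume)
  have h := measure_eq_zero_iff_ae_notMem.mp hnull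
  filter_upwards [h] with y hy
  simpa using hy

/-- `Θ_s(· − x_c)` is an almost-everywhere lift of the boundary map of `Φ_ρ` precomposed with the rotation by `x_c`:
`e^{iΘ_s(y − x_c)} = (e^{i(y − x_c)} − ρ)/(1 − ρe^{i(y − x_c)})` for a.e. `y`. [folklore] -/
theorem ae_cexp_moebiusAngle_sub_mul_I {s : ℝ} (hs : 0 < s) (x_c : ℝ) :
    ∀ᵐ y : ℝ, Complex.exp (moebiusAngle s (y - x_c) * I)
      = (Complex.exp ((y - x_c : ℝ) * I) - (((s - 1) / (s + 1) : ℝ) : ℂ))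
          / (1 - (((s - 1) / (s + 1) : ℝ) : ℂ) * Complex.exp ((y - x_c : ℝ) * I)) := by
  filter_upwards [ae_cos_half_sub_ne_zero x_c] with y hy
  exact cexp_moebiusAngle_mul_I hs hy

/-! ### The engine kernel -/

/-- The engine's kernel denominator is positive: `(s² + 1) + (s² − 1) cos θ = (1 − cos θ) + s²(1 + cos θ) > 0` for `s > 0`.
[folklore] -/
theorem engineDenom_pos {s : ℝ} (hs : 0 < s) (θ : ℝ) : 0 < (s ^ 2 + 1) + (s ^ 2 - 1) * Real.cos θ := by
  have h := moebiusDenom_pos hs (θ + π)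
  rw [Real.cos_add_pi] at h
  linarith

/-- **The conjugate Poisson kernel in the engine's letters.** With `ρ = (s − 1)/(s + 1)` (`s > 0`):
`2ρ sin θ/(1 + 2ρ cos θ + ρ²) = (s² − 1) sin θ/((s² + 1) + (s² − 1) cos θ)`. [folklore] -/
theorem conjPoisson_kernel_eq_engine_kernel {s : ℝ} (hs : 0 < s) (θ : ℝ) :
    2 * ((s - 1) / (s + 1)) * Real.sin θ / (1 + 2 * ((s - 1) / (s + 1)) * Real.cos θ + ((s - 1) / (s + 1)) ^ 2)
      = (s ^ 2 - 1) * Real.sin θ / ((s ^ 2 + 1) + (s ^ 2 - 1) * Real.cos θ) := by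
  have hs1 : s + 1 ≠ 0 := by positivity
  have hD : (s ^ 2 + 1) + (s ^ 2 - 1) * Real.cos θ ≠ 0 := (engineDenom_pos hs θ).ne'
  have hD' : 1 + 2 * ((s - 1) / (s + 1)) * Real.cos θ + ((s - 1) / (s + 1)) ^ 2 ≠ 0 := by
    have : 1 + 2 * ((s - 1) / (s + 1)) * Real.cos θ + ((s - 1) / (s + 1)) ^ 2
        = 2 * ((s ^ 2 + 1) + (s ^ 2 - 1) * Real.cos θ) / (s + 1) ^ 2 := by
      field_simp
      ring
    rw [this]
    positivity
  rw [div_eq_div_iff hD' hD]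
  field_simp
  ring

/-! ### The u5t identity -/

/-- **The Hilbert-transform identity of the u5t engine is exact.** Let `s > 0`, `x_c ∈ ℝ`, let
`g(θ) = c + Σ_{k<n} (α_k sin((k+1)θ) + β_k cos((k+1)θ))` be band-limited data in the mapped variable, and let
`ω(x) = g(Θ_s(x − x_c))` be the corresponding periodic function of the physical variable (`Θ_s = moebiusAngle s`). Then at every
`x` off the pole line (`cos((x − x_c)/2) ≠ 0`):
`(Hω)(x) = (Hg)(Θ_s(x − x_c)) − ((s² − 1)/(2π)) ∫₀^{2π} g(θ) sin θ/((s² + 1) + (s² − 1) cos θ) dθ`,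
`H = hilbertTransformCircle` (p.v. `cot` kernel, `H cos = sin`) on both sides — i.e. `(H_x ω)∘X = H_θ(ω∘X) − const` with the engine's
constant (ENGINE-E5 §11). Proof: conformal covariance of the conjugate function under the disc automorphism `Φ_ρ`, `ρ = (s−1)/(s+1)`
(`hilbertTransformCircle_trigPoly_moebius_integral`), the a.e. lift `cexp_moebiusAngle_mul_I`, translation covariance, and
`conjPoisson_kernel_eq_engine_kernel`. WHAT THIS IS NOT: not NS; an identity of harmonic analysis about the engine's formula.
[folklore] -/
theorem u5t_hilbertTransform_identity {s : ℝ} (hs : 0 < s) (x_c : ℝ) (n : ℕ) (c : ℝ) (α β : ℕ → ℝ) {x : ℝ}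
    (hx : Real.cos ((x - x_c) / 2) ≠ 0) :
    hilbertTransformCircle (fun y => c + ∑ k ∈ Finset.range n,
        (α k * Real.sin (((k + 1 : ℕ) : ℝ) * moebiusAngle s (y - x_c))
          + β k * Real.cos (((k + 1 : ℕ) : ℝ) * moebiusAngle s (y - x_c)))) x =
      hilbertTransformCircle (fun θ => c + ∑ k ∈ Finset.range n,
          (α k * Real.sin (((k + 1 : ℕ) : ℝ) * θ) + β k * Real.cos (((k + 1 : ℕ) : ℝ) * θ))) (moebiusAngle s (x - x_c))
        - (s ^ 2 - 1) / (2 * π) * ∫ θ in (0 : ℝ)..2 * π,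
            (c + ∑ k ∈ Finset.range n, (α k * Real.sin (((k + 1 : ℕ) : ℝ) * θ) + β k * Real.cos (((k + 1 : ℕ) : ℝ) * θ)))
              * Real.sin θ / ((s ^ 2 + 1) + (s ^ 2 - 1) * Real.cos θ) := by
  have hρ : |(s - 1) / (s + 1)| < 1 := abs_moebius_rho_lt_one hs
  -- translation covariance: reduce to `x_c = 0` at the point `x − x_c`
  rw [hilbertTransformCircle_comp_sub_const (fun y => c + ∑ k ∈ Finset.range n,
        (α k * Real.sin (((k + 1 : ℕ) : ℝ) * moebiusAngle s y) + β k * Real.cos (((k + 1 : ℕ) : ℝ) * moebiusAngle s y)))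
      x_c x]
  -- the a.e. lift `Θ_s` and the lift condition at the point `x − x_c`
  have hae : ∀ᵐ y : ℝ, Complex.exp (moebiusAngle s y * I)
      = (Complex.exp (y * I) - (((s - 1) / (s + 1) : ℝ) : ℂ)) / (1 - (((s - 1) / (s + 1) : ℝ) : ℂ) * Complex.exp (y * I)) := by
    filter_upwards [ae_cos_half_sub_ne_zero 0] with y hy
    rw [sub_zero] at hy
    exact cexp_moebiusAngle_mul_I hs hy
  have hpt := cexp_moebiusAngle_mul_I hs hx
  rw [hilbertTransformCircle_trigPoly_moebius_integral hρ hae hpt n c α β]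
  -- the kernel in the engine's letters
  have hker : ∫ θ in (0 : ℝ)..2 * π, 2 * ((s - 1) / (s + 1)) * Real.sin θ
        / (1 + 2 * ((s - 1) / (s + 1)) * Real.cos θ + ((s - 1) / (s + 1)) ^ 2)
        * (c + ∑ k ∈ Finset.range n, (α k * Real.sin (((k + 1 : ℕ) : ℝ) * θ) + β k * Real.cos (((k + 1 : ℕ) : ℝ) * θ)))
      = (s ^ 2 - 1) * ∫ θ in (0 : ℝ)..2 * π,
        (c + ∑ k ∈ Finset.range n, (α k * Real.sin (((k + 1 : ℕ) : ℝ) * θ) + β k * Real.cos (((k + 1 : ℕ) : ℝ) * θ)))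
          * Real.sin θ / ((s ^ 2 + 1) + (s ^ 2 - 1) * Real.cos θ) := by
    rw [← intervalIntegral.integral_const_mul]
    refine intervalIntegral.integral_congr fun θ _ => ?_
    rw [conjPoisson_kernel_eq_engine_kernel hs θ]
    ring
  rw [hker]
  ring

end Summit.NavierStokesRegularity.OSWSelfSimilar.MoebiusAngleHilbertCovariance
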